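import Mathlib
import Literature.NumberTheory.GaloisRepresentations.IntegralGaloisActionProofs
import Summits.Langlands.Langlands.Theorems.PicardMuOrdinaryResidualAutomorphyOddDiscriminant
import HarnessLib

/-!
# Dedekind's recipe for a quartic (helper for item stmt-Langlands-13759, route PicardMuOrdinary)

Let `f ∈ ℤ[X]` be a quartic with leading coefficient `a` and distinct roots `r₀,…,r₃ ∈ ℚ̄`, let `𝔓 ∣ p`
be a prime of `ℤ̄` (the tree's `absIntegers (𝓞 ℚ) ℚ`) and `Φ ∈ Γ_ℚ` an arithmetic Frobenius at `𝔓`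
(`IsArithFrobAt`) permuting the roots through `π ∈ S₄`.  If `p ∤ 2 a disc(f)`, then in every finite
field `F` with `p^e` elements the number of distinct roots of `f` is the number of fixed points of
`π^e`, and `disc(f)` is a square in `F` iff `π^e` is even (`dedekind_quartic`).  Proof: reduce the
algebraic integers `yᵢ = a rᵢ` modulo `𝔓` into an algebraic closure `Ω` of `ℤ̄/𝔓`; Frobenius gives
`ȳ_{π i} = ȳᵢ^p`, the `ȳᵢ` are distinct (`∏_{i<j}(yᵢ - yⱼ)² = a⁶ disc f`), the roots of `f` in `Ω` are
the `ȳᵢ / a` (integral normalisation), `F` embeds onto `{z | z^{p^e} = z}`, and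
`(∏_{i<j}(ȳᵢ - ȳⱼ))^{p^e} = sign(π^e) ∏_{i<j}(ȳᵢ - ȳⱼ)`.
-/

set_option linter.dupNamespace false -- project-wide option (lakefile weak.linter.dupNamespace); `Summit.Langlands.Langlands` is the mandated namespace

noncomputable section

open scoped Polynomial
open Polynomial Finset

namespace Summit.Langlands.Langlands.Theorems.ResidualAutomorphyOdd

/-! ### Roots of an integer quartic in `ℚ̄`, their integral multiples, and reduction modulo `𝔓` -/

section Frobenius

open NumberField Field IsDedekindDomain Literature.NumberTheory.GaloisRepresentations

/-- `ℚ̄`. -/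
abbrev Qbar : Type := AlgebraicClosure ℚ

/-- `ℤ̄ ⊆ ℚ̄` (as the integral closure of `𝓞 ℚ`, the carrier of the tree's Frobenius elements). -/
abbrev Sbar : Type := absIntegers (𝓞 ℚ) ℚ

variable {f : ℤ[X]} {r : Fin 4 → Qbar}

/-- The algebraic integers `yᵢ = a rᵢ` (`a` the leading coefficient). -/
def intRoot (f : ℤ[X]) (r : Fin 4 → Qbar) (hroot : ∀ i, aeval (r i) f = 0) (i : Fin 4) : Sbar :=
  ⟨(f.leadingCoeff : Qbar) * r i, by
    have h := isIntegral_leadingCoeff_smul f (r i) (hroot i)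
    rw [zsmul_eq_mul] at h
    exact h.tower_top⟩

/-- Unfolding `intRoot` in `ℚ̄`. -/
@[simp] theorem coe_intRoot (hroot : ∀ i, aeval (r i) f = 0) (i : Fin 4) :
    ((intRoot f r hroot i : Sbar) : Qbar) = (f.leadingCoeff : Qbar) * r i := rfl

/-- `f = a ∏ (X - rᵢ)` over `ℚ̄` when the `rᵢ` are four distinct roots of the quartic `f`. -/
theorem map_eq_C_mul_rootPoly (hdeg : f.natDegree = 4) (hr : Function.Injective r)
    (hroot : ∀ i, aeval (r i) f = 0) :
    f.map (Int.castRingHom Qbar) = C ((f.leadingCoeff : Qbar)) * rootPoly r := by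
  set g := f.map (Int.castRingHom Qbar) with hg
  have hinj : Function.Injective (Int.castRingHom Qbar) := Int.cast_injective
  have hg0 : g ≠ 0 := by
    rw [hg, Ne, Polynomial.map_eq_zero_iff hinj]
    rintro rfl; simp at hdeg
  have hgdeg : g.natDegree = 4 := by rw [hg, natDegree_map_eq_of_injective hinj, hdeg]
  have hle : (Finset.univ.val.map r) ≤ g.roots := by
    rw [Multiset.le_iff_subset ((Multiset.nodup_map_iff_of_injective hr).2 Finset.univ.nodup)]
    intro x hx
    obtain ⟨i, -, rfl⟩ := Multiset.mem_map.1 hx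
    rw [mem_roots hg0, IsRoot.def, hg, eval_map, ← algebraMap_int_eq, ← aeval_def]
    exact hroot i
  have hcard : Multiset.card g.roots = g.natDegree := by
    apply le_antisymm (card_roots' g)
    rw [hgdeg]
    simpa using Multiset.card_le_card hle
  have hroots : g.roots = Finset.univ.val.map r :=
    (Multiset.eq_of_le_of_card_le hle (by rw [hcard, hgdeg]; simp)).symm
  have h := C_leadingCoeff_mul_prod_multiset_X_sub_C hcard
  rw [hroots] at h
  rw [← h, rootPoly_eq_multiset]
  congr 2
  rw [hg, leadingCoeff_map_of_injective hinj, eq_intCast]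

/-- `Δ = ∏_{i<j} (yᵢ - yⱼ) ∈ ℤ̄` satisfies `Δ² = a⁶ · disc(f)`. -/
theorem sq_prod_intRoot_sub (hdeg : f.natDegree = 4) (hr : Function.Injective r)
    (hroot : ∀ i, aeval (r i) f = 0) :
    ((∏ i, ∏ j ∈ Finset.Ioi i, (intRoot f r hroot i - intRoot f r hroot j) : Sbar) : Qbar) ^ 2 =
      (f.leadingCoeff : Qbar) ^ 6 * (f.discr : Qbar) := by
  have ha : (Int.castRingHom Qbar) f.leadingCoeff ≠ 0 := by
    rw [eq_intCast, Int.cast_ne_zero, Ne, leadingCoeff_eq_zero]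
    rintro rfl; simp at hdeg
  have hdisc : (f.discr : Qbar) = (f.map (Int.castRingHom Qbar)).discr := by
    rw [discr_map _ ha, eq_intCast]
  have ha' : (f.leadingCoeff : Qbar) ≠ 0 := by rwa [eq_intCast] at ha
  rw [hdisc, map_eq_C_mul_rootPoly hdeg hr hroot, discr_C_mul_rootPoly r ha']
  push_cast
  simp only [coe_intRoot]
  have : (∏ i, ∏ j ∈ Finset.Ioi i, ((f.leadingCoeff : Qbar) * r i - (f.leadingCoeff : Qbar) * r j)) =
      (f.leadingCoeff : Qbar) ^ 6 * ∏ i, ∏ j ∈ Finset.Ioi i, (r i - r j) := by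
    simp only [Fin.prod_univ_four, Ioi_zero_fin4, Ioi_one_fin4, Ioi_two_fin4, Ioi_three_fin4,
      Finset.prod_empty,
      Finset.prod_insert (show (1 : Fin 4) ∉ ({2, 3} : Finset (Fin 4)) by decide),
      Finset.prod_insert (show (2 : Fin 4) ∉ ({3} : Finset (Fin 4)) by decide), Finset.prod_singleton]
    ring
  rw [this]
  ring

variable {v : HeightOneSpectrum (𝓞 ℚ)} {𝔓 : Ideal Sbar} {Φ : absoluteGaloisGroup ℚ} {π : Equiv.Perm (Fin 4)}
  {p : ℕ}

/-- Integers in `v`: `n ∈ v` iff `p ∣ n`. -/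
theorem intCast_mem_iff (hp : p.Prime) (hvp : (p : 𝓞 ℚ) ∈ v.asIdeal) (n : ℤ) :
    (n : 𝓞 ℚ) ∈ v.asIdeal ↔ (p : ℤ) ∣ n := by
  constructor
  · intro hn
    by_contra hnd
    have hcop : IsCoprime (p : ℤ) n := (Prime.coprime_iff_not_dvd (Nat.prime_iff_prime_int.1 hp)).2 hnd
    obtain ⟨u, w, huw⟩ := hcop
    have h1 : (1 : 𝓞 ℚ) ∈ v.asIdeal := by
      have : (u : 𝓞 ℚ) * (p : 𝓞 ℚ) + (w : 𝓞 ℚ) * (n : 𝓞 ℚ) = 1 := by exact_mod_cast huw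
      rw [← this]
      exact v.asIdeal.add_mem (v.asIdeal.mul_mem_left _ hvp) (v.asIdeal.mul_mem_left _ hn)
    exact v.isPrime.ne_top ((Ideal.eq_top_iff_one _).2 h1)
  · rintro ⟨k, rfl⟩
    push_cast
    exact v.asIdeal.mul_mem_right _ hvp

/-- An integer lies in `𝔓 ∣ v` iff `p` divides it. -/
theorem intCast_mem_prime_iff (hp : p.Prime) (hvp : (p : 𝓞 ℚ) ∈ v.asIdeal) (h𝔓 : 𝔓 ∈ v.primesAbove)
    (n : ℤ) : (n : Sbar) ∈ 𝔓 ↔ (p : ℤ) ∣ n := by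
  rw [← intCast_mem_iff hp hvp n, h𝔓.2.over, Ideal.under_def, Ideal.mem_comap, map_intCast]

variable (hroot : ∀ i, aeval (r i) f = 0)

/-- The Frobenius relation `y_{π i} ≡ yᵢ ^ p (mod 𝔓)`. -/
theorem mk_intRoot_perm (h𝔓 : 𝔓 ∈ v.primesAbove) (hΦ : IsArithFrobAt (𝓞 ℚ) Φ 𝔓)
    (hπ : ∀ i, Φ • r i = r (π i)) (i : Fin 4) :
    Ideal.Quotient.mk 𝔓 (intRoot f r hroot (π i)) = Ideal.Quotient.mk 𝔓 (intRoot f r hroot i) ^ v.residueCard := by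
  have h := (HeightOneSpectrum.isArithFrobAt_iff_of_mem_primesAbove h𝔓 Φ).1 hΦ (intRoot f r hroot i)
  have hsmul : Φ • intRoot f r hroot i = intRoot f r hroot (π i) := by
    apply Subtype.ext
    rw [integralClosure.coe_smul, coe_intRoot, coe_intRoot, smul_mul', hπ i]
    congr 1
    rw [absoluteGaloisGroup.smul_def, map_intCast]
  rw [hsmul] at h
  rw [← map_pow, eq_comm, ← sub_eq_zero, ← map_sub, Ideal.Quotient.eq_zero_iff_mem]
  have : intRoot f r hroot i ^ v.residueCard - intRoot f r hroot (π i) =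
      -(intRoot f r hroot (π i) - intRoot f r hroot i ^ v.residueCard) := by ring
  rw [this]
  exact 𝔓.neg_mem_iff.2 h

/-- Iterated Frobenius relation. -/
theorem mk_intRoot_perm_pow (h𝔓 : 𝔓 ∈ v.primesAbove) (hΦ : IsArithFrobAt (𝓞 ℚ) Φ 𝔓)
    (hπ : ∀ i, Φ • r i = r (π i)) (e : ℕ) (i : Fin 4) :
    Ideal.Quotient.mk 𝔓 (intRoot f r hroot ((π ^ e) i)) =
      Ideal.Quotient.mk 𝔓 (intRoot f r hroot i) ^ v.residueCard ^ e := by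
  induction e generalizing i with
  | zero => simp
  | succ e ih =>
    rw [pow_succ', Equiv.Perm.mul_apply, mk_intRoot_perm hroot h𝔓 hΦ hπ, ih, ← pow_mul, ← pow_succ]

/-! ### Dedekind's recipe -/

include hroot in
/-- **Dedekind's recipe for a quartic.**  Let `f ∈ ℤ[X]` be a quartic with distinct roots
`r₀,…,r₃ ∈ ℚ̄`, let `Φ` be an arithmetic Frobenius at a prime `𝔓 ∣ p` of `ℤ̄` permuting the roots
through `π`, and let `p ∤ 2 a disc(f)`.  Then in a finite field `F` with `p ^ e` elements, the
number of distinct roots of `f` is the number of fixed points of `π ^ e`, and `disc(f)` is a square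
in `F` iff `π ^ e` is even. -/
theorem dedekind_quartic (hp : p.Prime) (hvp : (p : 𝓞 ℚ) ∈ v.asIdeal) (hq : v.residueCard = p)
    (h𝔓 : 𝔓 ∈ v.primesAbove) (hΦ : IsArithFrobAt (𝓞 ℚ) Φ 𝔓) (hπ : ∀ i, Φ • r i = r (π i))
    (hdeg : f.natDegree = 4) (hr : Function.Injective r)
    (hbad : ¬ (p : ℤ) ∣ 2 * f.leadingCoeff * f.discr)
    (F : Type*) [Field F] [Fintype F] [DecidableEq F] {e : ℕ} (hF : Fintype.card F = p ^ e) :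
    (f.map (Int.castRingHom F)).roots.toFinset.card =
        (Finset.univ.filter fun i => (π ^ e) i = i).card ∧
      ((∃ w : F, w ^ 2 = (f.map (Int.castRingHom F)).discr) ↔ Equiv.Perm.sign (π ^ e) = 1) := by
  classical
  haveI hpfact : Fact p.Prime := ⟨hp⟩
  have hpZ : Prime (p : ℤ) := Nat.prime_iff_prime_int.1 hp
  have hpa : ¬ (p : ℤ) ∣ f.leadingCoeff := fun h =>
    hbad (dvd_mul_of_dvd_left (dvd_mul_of_dvd_right h _) _)
  have hp2 : ¬ (p : ℤ) ∣ 2 := fun h => hbad (dvd_mul_of_dvd_left (dvd_mul_of_dvd_left h _) _)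
  have hpd : ¬ (p : ℤ) ∣ f.discr := fun h => hbad (dvd_mul_of_dvd_right h _)
  have hf0 : f ≠ 0 := by rintro rfl; simp at hdeg
  -- the residue field at `𝔓` and an algebraic closure `Ω` of it
  haveI : CharP F p := charP_of_card_eq_prime_pow hF
  haveI h𝔓max : 𝔓.IsMaximal := HeightOneSpectrum.isMaximal_of_mem_primesAbove h𝔓
  letI : Field (Sbar ⧸ 𝔓) := Ideal.Quotient.field 𝔓
  have hpS : ((p : ℤ) : Sbar) ∈ 𝔓 := (intCast_mem_prime_iff hp hvp h𝔓 p).2 dvd_rfl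
  haveI : CharP (Sbar ⧸ 𝔓) p := (CharP.charP_iff_prime_eq_zero hp).2 (by
    have h := (Ideal.Quotient.eq_zero_iff_mem).2 hpS
    simpa using h)
  let Ω := AlgebraicClosure (Sbar ⧸ 𝔓)
  letI : Algebra (ZMod p) F := ZMod.algebra F p
  letI : Algebra (ZMod p) Ω := ZMod.algebra Ω p
  haveI : Algebra.IsAlgebraic (ZMod p) F := Algebra.IsAlgebraic.of_finite (ZMod p) F
  let ι : F →+* Ω := (IsAlgClosed.lift (R := ZMod p) (M := Ω) (S := F)).toRingHom
  let red : Sbar →+* Ω := (algebraMap (Sbar ⧸ 𝔓) Ω).comp (Ideal.Quotient.mk 𝔓)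
  have hred_eq_zero : ∀ x : Sbar, red x = 0 ↔ x ∈ 𝔓 := by
    intro x
    simp only [red, RingHom.comp_apply, map_eq_zero_iff _ (algebraMap (Sbar ⧸ 𝔓) Ω).injective,
      Ideal.Quotient.eq_zero_iff_mem]
  set y : Fin 4 → Ω := fun i => red (intRoot f r hroot i) with hy
  -- (1) Frobenius
  have hy_frob : ∀ i, y ((π ^ e) i) = y i ^ p ^ e := by
    intro i
    simp only [hy, red, RingHom.comp_apply, mk_intRoot_perm_pow hroot h𝔓 hΦ hπ e i, map_pow, hq]
  -- (2) the element `Δ`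
  set Δ : Sbar := ∏ i, ∏ j ∈ Finset.Ioi i, (intRoot f r hroot i - intRoot f r hroot j) with hΔdef
  have hΔsq : Δ ^ 2 = ((f.leadingCoeff ^ 6 * f.discr : ℤ) : Sbar) := by
    apply Subtype.ext
    have h := sq_prod_intRoot_sub hdeg hr hroot
    simp only [hΔdef]
    push_cast at h ⊢
    exact h
  have hΔ : Δ ∉ 𝔓 := by
    intro h
    have h2 : Δ ^ 2 ∈ 𝔓 := 𝔓.pow_mem_of_mem h 2 (by norm_num)
    rw [hΔsq] at h2
    rcases hpZ.dvd_or_dvd ((intCast_mem_prime_iff hp hvp h𝔓 _).1 h2) with h6 | hd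
    · exact hpa (hpZ.dvd_of_dvd_pow h6)
    · exact hpd hd
  have hΔred : red Δ ≠ 0 := by rwa [Ne, hred_eq_zero]
  have hredΔ : red Δ = ∏ i, ∏ j ∈ Finset.Ioi i, (y i - y j) := by
    simp only [hΔdef, map_prod, map_sub, hy]
  -- (3) the reduced roots are distinct
  have hy_inj : Function.Injective y := by
    intro i j hij
    by_contra hne
    apply hΔred
    rw [hredΔ]
    rcases lt_or_gt_of_ne hne with h | h
    · exact Finset.prod_eq_zero (Finset.mem_univ i)
        (Finset.prod_eq_zero (Finset.mem_Ioi.2 h) (sub_eq_zero.2 hij))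
    · exact Finset.prod_eq_zero (Finset.mem_univ j)
        (Finset.prod_eq_zero (Finset.mem_Ioi.2 h) (sub_eq_zero.2 hij.symm))
  -- (4) the leading coefficient and `2` are units mod `p`
  set a : ℤ := f.leadingCoeff with hadef
  have ha : (a : Ω) ≠ 0 := by rw [Ne, CharP.intCast_eq_zero_iff Ω p]; exact hpa
  have haF : (a : F) ≠ 0 := by rw [Ne, CharP.intCast_eq_zero_iff F p]; exact hpa
  have h2 : (2 : Ω) ≠ 0 := by
    have h : ((2 : ℤ) : Ω) ≠ 0 := by rw [Ne, CharP.intCast_eq_zero_iff Ω p]; exact hp2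
    exact_mod_cast h
  have hιa : ι (a : F) = (a : Ω) := map_intCast ι a
  have hιcomp : ι.comp (Int.castRingHom F) = Int.castRingHom Ω := RingHom.ext_int _ _
  -- (5) the image of `F`
  have hrange : ∀ z : Ω, z ∈ Set.range ι ↔ z ^ p ^ e = z := by
    intro z; rw [mem_range_iff_pow_card_eq ι z, hF]
  have ha_pow : (a : Ω) ^ p ^ e = (a : Ω) := (hrange _).1 ⟨(a : F), hιa⟩
  -- (6) the integral normalisation `G` of `f` reduces to `∏ (X - yᵢ)`
  set G : ℤ[X] := integralNormalization f with hGdef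
  have hG1 : (1 : ℕ) ≤ f.natDegree := by omega
  have hGeval : ∀ z : Ω, (G.map (Int.castRingHom Ω)).eval ((a : Ω) * z) =
      (a : Ω) ^ 3 * (f.map (Int.castRingHom Ω)).eval z := by
    intro z
    have h := integralNormalization_eval₂_leadingCoeff_mul hG1 (Int.castRingHom Ω) z
    rw [eval_map, eval_map, eq_intCast] at *
    rw [hdeg] at h
    exact h
  have hGroot : ∀ i, (G.map (Int.castRingHom Ω)).eval (y i) = 0 := by
    intro i
    have h1 : G.eval₂ (Int.castRingHom Sbar) (intRoot f r hroot i) = 0 := by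
      have hinj : Function.Injective (algebraMap Sbar Qbar) := Subtype.val_injective
      apply hinj
      rw [map_zero, hom_eval₂,
        RingHom.ext_int ((algebraMap Sbar Qbar).comp (Int.castRingHom Sbar)) (Int.castRingHom Qbar)]
      change G.eval₂ (Int.castRingHom Qbar) ((f.leadingCoeff : Qbar) * r i) = 0
      have h := integralNormalization_eval₂_leadingCoeff_mul hG1 (Int.castRingHom Qbar) (r i)
      rw [eq_intCast] at h
      rw [h]
      have h0 : f.eval₂ (Int.castRingHom Qbar) (r i) = 0 := by
        rw [← algebraMap_int_eq, ← aeval_def]; exact hroot i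
      rw [h0, mul_zero]
    show (G.map (Int.castRingHom Ω)).eval (red (intRoot f r hroot i)) = 0
    rw [eval_map, ← RingHom.ext_int (red.comp (Int.castRingHom Sbar)) (Int.castRingHom Ω), ← hom_eval₂,
      h1, map_zero]
  have hGmonic : (G.map (Int.castRingHom Ω)).Monic := (monic_integralNormalization hf0).map _
  have hGdeg : (G.map (Int.castRingHom Ω)).natDegree = 4 := by
    rw [(monic_integralNormalization hf0).natDegree_map, natDegree_integralNormalization, hdeg]
  have hGbar : G.map (Int.castRingHom Ω) = rootPoly y := by
    set Gb := G.map (Int.castRingHom Ω) with hGb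
    have hGb0 : Gb ≠ 0 := hGmonic.ne_zero
    have hle : (Finset.univ.val.map y) ≤ Gb.roots := by
      rw [Multiset.le_iff_subset ((Multiset.nodup_map_iff_of_injective hy_inj).2 Finset.univ.nodup)]
      intro x hx
      obtain ⟨i, -, rfl⟩ := Multiset.mem_map.1 hx
      rw [mem_roots hGb0, IsRoot.def]
      exact hGroot i
    have hcard : Multiset.card Gb.roots = Gb.natDegree := by
      apply le_antisymm (card_roots' Gb)
      rw [hGdeg]
      simpa using Multiset.card_le_card hle
    have hroots : Gb.roots = Finset.univ.val.map y :=
      (Multiset.eq_of_le_of_card_le hle (by rw [hcard, hGdeg]; simp)).symm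
    rw [← prod_multiset_X_sub_C_of_monic_of_roots_card_eq hGmonic hcard, hroots, rootPoly_eq_multiset]
  -- (7) roots of `f` in `Ω` are the `yᵢ / a`
  set fΩ := f.map (Int.castRingHom Ω) with hfΩ
  have hfroot : ∀ z : Ω, fΩ.eval z = 0 ↔ ∃ i, (a : Ω) * z = y i := by
    intro z
    have hmem : (a : Ω) * z ∈ (rootPoly y).roots ↔ ∃ i, (a : Ω) * z = y i := by
      rw [roots_rootPoly, Multiset.mem_map]
      constructor
      · rintro ⟨i, -, hi⟩; exact ⟨i, hi.symm⟩
      · rintro ⟨i, hi⟩; exact ⟨i, Finset.mem_univ_val i, hi.symm⟩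
    rw [← hmem, mem_roots (monic_rootPoly y).ne_zero, IsRoot.def, ← hGbar, hGeval z]
    constructor
    · intro hz; rw [hz, mul_zero]
    · intro hz
      rcases mul_eq_zero.1 hz with h | h
      · exact absurd h (pow_ne_zero 3 ha)
      · exact h
  -- (8) counting roots in `F`
  set fF := f.map (Int.castRingHom F) with hfF
  have hleadF : (Int.castRingHom F) f.leadingCoeff ≠ 0 := by rw [eq_intCast]; exact haF
  have hfF0 : fF ≠ 0 := fun h => hleadF (by
    rw [← leadingCoeff_map_of_leadingCoeff_ne_zero _ hleadF, ← hfF, h, leadingCoeff_zero])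
  have hfΩF : fΩ = fF.map ι := by rw [hfF, Polynomial.map_map, hιcomp]
  have hevalι : ∀ x : F, fΩ.eval (ι x) = ι (fF.eval x) := by
    intro x; rw [hfΩF, eval_map, eval₂_hom]
  have hfix : ∀ i, (π ^ e) i = i ↔ y i ∈ Set.range ι := by
    intro i
    rw [hrange, ← hy_frob, hy_inj.eq_iff]
  have hcount : fF.roots.toFinset.card = (Finset.univ.filter fun i => (π ^ e) i = i).card := by
    have himg : fF.roots.toFinset.image ι =
        (Finset.univ.filter fun i => (π ^ e) i = i).image fun i => y i / (a : Ω) := by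
      ext z
      simp only [Finset.mem_image, Multiset.mem_toFinset, mem_roots hfF0, IsRoot.def, Finset.mem_filter,
        Finset.mem_univ, true_and]
      constructor
      · rintro ⟨x, hx, rfl⟩
        have h0 : fΩ.eval (ι x) = 0 := by rw [hevalι, hx, map_zero]
        obtain ⟨i, hi⟩ := (hfroot _).1 h0
        refine ⟨i, (hfix i).2 ⟨(a : F) * x, by rw [map_mul, hιa, hi]⟩, ?_⟩
        rw [← hi, mul_div_cancel_left₀ _ ha]
      · rintro ⟨i, hi, rfl⟩
        obtain ⟨w, hw⟩ := (hfix i).1 hi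
        refine ⟨w / (a : F), ?_, by rw [map_div₀, hιa, hw]⟩
        apply ι.injective
        rw [map_zero, ← hevalι, map_div₀, hιa, hw]
        exact (hfroot _).2 ⟨i, mul_div_cancel₀ _ ha⟩
    have hinj2 : Function.Injective fun i => y i / (a : Ω) := by
      intro i j hij
      exact hy_inj ((div_left_inj' ha).1 hij)
    rw [← Finset.card_image_of_injective _ ι.injective, himg, Finset.card_image_of_injective _ hinj2]
  refine ⟨hcount, ?_⟩
  -- (9) the discriminant
  have hdiscΩ : (red Δ) ^ 2 = (a : Ω) ^ 6 * (f.discr : Ω) := by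
    have h := congr_arg red hΔsq
    rw [map_pow, map_intCast] at h
    push_cast at h
    exact h
  have hdiscF : ι fF.discr = (f.discr : Ω) := by
    have hleadι : ι fF.leadingCoeff ≠ 0 := by
      rw [hfF, leadingCoeff_map_of_leadingCoeff_ne_zero _ hleadF, eq_intCast, hιa]; exact ha
    rw [← discr_map ι hleadι, ← hfΩF, hfΩ, discr_map _ (by rw [eq_intCast]; exact ha), eq_intCast]
  set D : Ω := red Δ / (a : Ω) ^ 3 with hD
  have hD2 : D ^ 2 = (f.discr : Ω) := by
    rw [hD, div_pow, div_eq_iff (pow_ne_zero _ (pow_ne_zero _ ha)), hdiscΩ]; ring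
  have hsqF : (∃ w : F, w ^ 2 = fF.discr) ↔ D ∈ Set.range ι := by
    constructor
    · rintro ⟨w, hw⟩
      have h : ι w ^ 2 = D ^ 2 := by rw [← map_pow, hw, hdiscF, hD2]
      rcases sq_eq_sq_iff_eq_or_eq_neg.1 h with h1 | h1
      · exact ⟨w, h1⟩
      · exact ⟨-w, by rw [map_neg, h1, neg_neg]⟩
    · rintro ⟨w, hw⟩
      refine ⟨w, ι.injective ?_⟩
      rw [map_pow, hw, hD2, hdiscF]
  have hDq : D ∈ Set.range ι ↔ red Δ ^ p ^ e = red Δ := by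
    rw [hrange, hD, div_pow, ← pow_mul, mul_comm 3, pow_mul, ha_pow, div_left_inj' (pow_ne_zero 3 ha)]
  have hΔq : red Δ ^ p ^ e = ((Equiv.Perm.sign (π ^ e) : ℤ) : Ω) * red Δ := by
    rw [hredΔ, ← Finset.prod_pow]
    simp_rw [← Finset.prod_pow, sub_pow_char_pow, ← hy_frob]
    exact Equiv.Perm.prod_Ioi_comp_eq_sign_mul_prod (π ^ e) (f := fun i j => y i - y j)
      (fun i j => (neg_sub (y j) (y i)).symm)
  rw [hsqF, hDq, hΔq]
  rcases Int.units_eq_one_or (Equiv.Perm.sign (π ^ e)) with h1 | h1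
  · simp [h1]
  · have hcast : ((Equiv.Perm.sign (π ^ e) : ℤ) : Ω) = -1 := by rw [h1]; simp
    rw [hcast, neg_one_mul, h1]
    constructor
    · intro h
      exfalso
      apply hΔred
      have h2' : (2 : Ω) * red Δ = 0 := by linear_combination (-1 : Ω) * h
      rcases mul_eq_zero.1 h2' with h3 | h3
      · exact absurd h3 h2
      · exact h3
    · intro h; exact absurd h (by decide)

end Frobenius

end Summit.Langlands.Langlands.Theorems.ResidualAutomorphyOdd
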